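import Literature.Geometry.Riemannian.SurgicalRicciFlowBridge
import Literature.Topology.FourManifolds.CerfPropositionFour
import HarnessLib

/-!
# Neck-surgery resolvability of closed simply connected PIC four-manifolds from the two leaves

This was the discharge file of the named fact `hamilton_pic_neckSurgery_resolvable_four` of
`HamiltonSurgeryProgramme.lean` — "a closed simply connected smooth four-manifold carrying a
metric of positive isotropic curvature is *neck-surgery resolvable*"
(`Literature.Geometry.Riemannian.IsNeckSurgeryResolvable`), the statement of R. Hamilton's
surgery programme (Comm. Anal. Geom. 5 (1997), §1.1 pp. 3–4 with Thm. 1.1, p. 2) in the simply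
connected case, completed by B.-L. Chen and X.-P. Zhu (J. Differential Geom. 74 (2006), Thm. 1.1
with §5). That fact was a decomposition child of Hamilton's Cor. 1.2(a)
`hamilton_pic_sphere_four` which is *equivalent to its parent manifold by manifold* (a simply
connected resolvable manifold is a connected sum of copies of `S⁴`,
`IsNeckSurgeryResolvable.isConnectedSumOfSpheres`, hence `S⁴` by Kervaire–Milnor's
`S⁴ # S⁴ ≅ S⁴`; conversely `S⁴` is a model piece) and which reduces, by theorems already in the
tree, to the same two leaves as its parent; carrying no proof burden of its own, it has been
merged back into `hamilton_pic_sphere_four` (D-0026). This file keeps the composed reduction,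
stated pointwise, and introduces no named fact.

The statement has exactly one published proof — the Ricci flow with surgery (Hamilton 1997
§§2–5; Chen–Zhu 2006 §§2–5 on Perelman's techniques) followed by the topological reconstruction
of the manifold from the pieces left by the surgeries. The tree holds the whole reduction to two
**leaf** named facts as theorems:

* `cerf_pi0Diff_sphere_three_of_relBoundary` (`CerfPropositionFour.lean`): Cerf's
  `π₀ Diff(D³ rel ∂) = 0` (`cerf_pi0DiffDisc_relBoundary_three`) gives `π₀ Diff⁺ S³ = 0` in the
  tree's form `cerf_pi0Diff_sphere_three` [cite: CerfDiffeoSphere1968, Ch. I §2];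
* `forall_component_isNeckSurgeryResolvable_of_chenZhuResolvableIn`
  (`SurgicalRicciFlowBridge.lean`): given `π₀ Diff⁺ S³ = 0`, every simply connected component of
  a closed four-manifold resolved by a Ricci flow with `m` surgeries (`ChenZhuResolvableIn m M g₀`,
  the structure asserted for PIC initial metrics by Chen–Zhu's Thm. 1.1, `SurgicalRicciFlow.lean`
  — in print "a direct consequence of" their long-time existence theorem Thm. 5.6, p. 43; no
  longer a named fact but an explicit hypothesis, being equivalent to `hamilton_chen_tang_zhu`
  modulo short-time existence and Cerf's theorem, `ChenZhuStructureFromClassification.lean`)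
  is neck-surgery resolvable, by the
  induction on `m` whose base is `IsUnionOfPieces.exists_isNeckSurgeryResolvable_component`
  (`HamiltonSurgeryProgrammeProofs.lean`) [cite: Hamilton1997, §1.1 pp. 3–4]
  [cite: ChenZhu2006, Thm. 1.1 (arXiv p. 3) with §5 (arXiv pp. 24–25)].

Composed here: under the structure statement of Thm. 1.1 and the leaf
`cerf_pi0DiffDisc_relBoundary_three`, and nothing else, every closed simply connected PIC four-manifold is neck-surgery resolvable
(`isNeckSurgeryResolvable_of_chenZhu_of_cerfRelBoundary`, `isNeckSurgeryResolvable_of_leaves`)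
and diffeomorphic to `S⁴` (`isNeckSurgeryResolvable_and_nonempty_diffeomorph_sphere_of_leaves`) —
the same two hypotheses as for the four equivalent vendings of Hamilton's theorem in the simply
connected case, `hamilton_pic_sphere_four`, `hamilton_chen_tang_zhu`,
`hamilton_pic_classification_four`, `hamilton_pic_connectedSum_spheres_four`
(`PICSphereFactsHolds.lean`, `HamiltonPICHolds.lean`).

## References

* R. S. Hamilton, *Four-manifolds with positive isotropic curvature*, Comm. Anal. Geom. 5 (1997)
  1–92, Thm. 1.1 (p. 2), Cor. 1.2(a) (p. 3), §1.1 pp. 3–4. [Hamilton1997]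
* B.-L. Chen, X.-P. Zhu, *Ricci flow with surgery on four-manifolds with positive isotropic
  curvature*, J. Differential Geom. 74 (2006) 177–264 (arXiv:math/0504478), Thm. 1.1 (p. 3),
  §5 (pp. 24–25), Thm. 5.6 (p. 43). [ChenZhu2006]
* J. Cerf, *Sur les difféomorphismes de la sphère de dimension trois (Γ₄ = 0)*, Lecture Notes in
  Mathematics 53, Springer 1968, Ch. I §§1–2. [CerfDiffeoSphere1968]
-/

open scoped Manifold ContDiff
open Set TopologicalSpace

namespace Literature.Geometry.Riemannian

open Literature.Topology.FourManifolds Lorentzian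

/-- **Neck-surgery resolvability from the structure theorem and Cerf's theorem.** Under the
structure statement of Chen–Zhu's Thm. 1.1 (a simply connected closed PIC 4-manifold is resolved
by a Ricci flow with finitely many surgeries, `ChenZhuResolvableIn`) and Cerf's theorem `π₀ Diff(D³ rel ∂) = 0`
(`cerf_pi0DiffDisc_relBoundary_three`), a closed simply connected four-manifold `M` carrying a
Riemannian metric of positive isotropic curvature is neck-surgery resolvable: Cerf's (2) gives
Théorème 1 (`cerf_pi0Diff_sphere_three_of_relBoundary`), Thm. 1.1 gives
`ChenZhuResolvableIn m M g`, and `forall_component_isNeckSurgeryResolvable_of_chenZhuResolvableIn`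
applies to the single component of `M` — Hamilton's "After a finite number of surgeries in a
finite time, and discarding a finite number of pieces, we are left with nothing" (1997, p. 3).
[cite: Hamilton1997, §1.1 pp. 3–4] [cite: ChenZhu2006, Thm. 1.1 (p. 3) with §5 (pp. 24–25)]
[cite: CerfDiffeoSphere1968, Ch. I §2] -/
theorem isNeckSurgeryResolvable_of_chenZhu_of_cerfRelBoundary
    (hCZ : ∀ (M : Type) [TopologicalSpace M] [T2Space M] [SecondCountableTopology M]
        [CompactSpace M] [ChartedSpace (EuclideanSpace ℝ (Fin 4)) M] [IsManifold (𝓡 4) ∞ M]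
        [SimplyConnectedSpace M]
        (g₀ : Literature.Geometry.Lorentzian.PseudoRiemannianMetric (𝓡 4) ∞
          (EuclideanSpace ℝ (Fin 4)) (TangentSpace (𝓡 4) : M → Type _)),
        g₀.IsRiemannian → g₀.HasPositiveIsotropicCurvature → ∃ m : ℕ, ChenZhuResolvableIn m M g₀)
    (hcerf : cerf_pi0DiffDisc_relBoundary_three)
    (M : Type) [TopologicalSpace M] [T2Space M] [SecondCountableTopology M]
    [ChartedSpace (EuclideanSpace ℝ (Fin 4)) M] [IsManifold (𝓡 4) ∞ M] [CompactSpace M]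
    [SimplyConnectedSpace M]
    (hg : ∃ g : PseudoRiemannianMetric (𝓡 4) ∞ (EuclideanSpace ℝ (Fin 4))
        (TangentSpace (𝓡 4) : M → Type _), g.IsRiemannian ∧ g.HasPositiveIsotropicCurvature) :
    IsNeckSurgeryResolvable M := by
  have hcerf' : cerf_pi0Diff_sphere_three := cerf_pi0Diff_sphere_three_of_relBoundary hcerf
  obtain ⟨g, hg, hpic⟩ := hg
  obtain ⟨m, hm⟩ := hCZ M g hg hpic
  haveI : PathConnectedSpace M := inferInstance
  obtain ⟨x⟩ := (inferInstance : Nonempty M)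
  have htop : ((⊤ : Opens M) : Set M) = univ := rfl
  obtain ⟨e⟩ := nonempty_diffeomorph_opens_of_coe_eq_univ (I := 𝓡 4) (⊤ : Opens M) htop
  have hsc : SimplyConnectedSpace (⊤ : Opens M) :=
    (e.toHomeomorph.toHomotopyEquiv.simplyConnectedSpace_iff).1 inferInstance
  have hres := forall_component_isNeckSurgeryResolvable_of_chenZhuResolvableIn hcerf' m M g hm ⊤
    ⟨x, by rw [htop, PreconnectedSpace.connectedComponent_eq_univ]⟩ hsc
  exact hres.of_diffeomorph e.symm

/-- **The hypotheses of neck-surgery resolvability in this tree, as a conjunction**: under the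
structure statement of Thm. 1.1 and Cerf's theorem, every closed simply connected PIC four-manifold is neck-surgery resolvable
(the converse is not claimed). [cite: Hamilton1997, §1.1 pp. 3–4] [cite: ChenZhu2006, Thm. 1.1 (p. 3)] -/
theorem isNeckSurgeryResolvable_of_leaves
    (h : (∀ (M : Type) [TopologicalSpace M] [T2Space M] [SecondCountableTopology M]
         [CompactSpace M] [ChartedSpace (EuclideanSpace ℝ (Fin 4)) M] [IsManifold (𝓡 4) ∞ M]
         [SimplyConnectedSpace M]
         (g₀ : Literature.Geometry.Lorentzian.PseudoRiemannianMetric (𝓡 4) ∞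
           (EuclideanSpace ℝ (Fin 4)) (TangentSpace (𝓡 4) : M → Type _)),
         g₀.IsRiemannian → g₀.HasPositiveIsotropicCurvature → ∃ m : ℕ, ChenZhuResolvableIn m M g₀) ∧
      cerf_pi0DiffDisc_relBoundary_three)
    (M : Type) [TopologicalSpace M] [T2Space M] [SecondCountableTopology M]
    [ChartedSpace (EuclideanSpace ℝ (Fin 4)) M] [IsManifold (𝓡 4) ∞ M] [CompactSpace M]
    [SimplyConnectedSpace M]
    (hg : ∃ g : PseudoRiemannianMetric (𝓡 4) ∞ (EuclideanSpace ℝ (Fin 4))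
        (TangentSpace (𝓡 4) : M → Type _), g.IsRiemannian ∧ g.HasPositiveIsotropicCurvature) :
    IsNeckSurgeryResolvable M :=
  isNeckSurgeryResolvable_of_chenZhu_of_cerfRelBoundary h.1 h.2 M hg

/-- The two hypotheses give resolvability *together with* Hamilton's Cor. 1.2(a): under them every
closed simply connected PIC four-manifold is both neck-surgery resolvable and diffeomorphic to
`S⁴` (`hamilton_pic_sphere_four_of_chenZhu_of_cerf`, `SurgicalRicciFlowBridge.lean`).
[cite: Hamilton1997, §1.1 pp. 3–4 and Cor. 1.2(a) (p. 3)] -/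
theorem isNeckSurgeryResolvable_and_nonempty_diffeomorph_sphere_of_leaves
    (h : (∀ (M : Type) [TopologicalSpace M] [T2Space M] [SecondCountableTopology M]
         [CompactSpace M] [ChartedSpace (EuclideanSpace ℝ (Fin 4)) M] [IsManifold (𝓡 4) ∞ M]
         [SimplyConnectedSpace M]
         (g₀ : Literature.Geometry.Lorentzian.PseudoRiemannianMetric (𝓡 4) ∞
           (EuclideanSpace ℝ (Fin 4)) (TangentSpace (𝓡 4) : M → Type _)),
         g₀.IsRiemannian → g₀.HasPositiveIsotropicCurvature → ∃ m : ℕ, ChenZhuResolvableIn m M g₀) ∧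
      cerf_pi0DiffDisc_relBoundary_three)
    (M : Type) [TopologicalSpace M] [T2Space M] [SecondCountableTopology M]
    [ChartedSpace (EuclideanSpace ℝ (Fin 4)) M] [IsManifold (𝓡 4) ∞ M] [CompactSpace M]
    [SimplyConnectedSpace M]
    (hg : ∃ g : PseudoRiemannianMetric (𝓡 4) ∞ (EuclideanSpace ℝ (Fin 4))
        (TangentSpace (𝓡 4) : M → Type _), g.IsRiemannian ∧ g.HasPositiveIsotropicCurvature) :
    IsNeckSurgeryResolvable M ∧
      Nonempty (M ≃ₘ⟮𝓡 4, 𝓡 4⟯ Metric.sphere (0 : EuclideanSpace ℝ (Fin 5)) 1) :=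
  ⟨isNeckSurgeryResolvable_of_leaves h M hg,
    hamilton_pic_sphere_four_of_chenZhu_of_cerf h.1 (cerf_pi0Diff_sphere_three_of_relBoundary h.2)
      M hg⟩

end Literature.Geometry.Riemannian
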